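import Literature.Analysis.FluidPDE.KNSSNoAxisymmetricTypeIHolds
import Literature.Analysis.FluidPDE.AxisymPoloidalPart
import Literature.Analysis.FluidPDE.SwirlMaximumPrinciple
import HarnessLib

/-!
# No axisymmetric blow-up under a `C/r` bound on the poloidal velocity alone

Seregin–Šverák state their local regularity criteria for axisymmetric Navier–Stokes solutions
with the scale-invariant bound placed on the **meridional (poloidal) part**
`v̄ = v_ϱ e_ϱ + v₃ e₃` of the velocity only:

> "The exact assumption which we will use […] in the axi-symmetric situation, with the `x₃`-axis
> as the axis of symmetry, is `sup_{(x,t) ∈ Q(z₀,R)} √(x₁²+x₂²) |v̄(x,t)| < +∞` for some `R > 0`,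
> where `z₀` lies on the `x₃`-axis and we denote by `v̄(x,t)` the projection of the velocity vector
> `v(x,t)` into the plane passing through `x` and the axis of symmetry `x₃`."
> (G. Seregin, V. Šverák, Comm. PDE 34 (2009) = arXiv:0804.1803, §1, p. 2, display (1.2);
> Theorem 1.2, p. 3.)

The tree's formalisation of that paper and of Koch–Nadirashvili–Seregin–Šverák 2009 carries the
bound on the FULL velocity (`Literature.Analysis.FluidPDE.knss_no_axisymmetric_typeI`, second
alternative `∃ C, ∀ t ∈ [0,T), ∀ x, r‖u(t,x)‖ ≤ C`, DISCHARGED as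
`knss_no_axisymmetric_typeI_holds`; the local Thm. 3.2 of §3, `SereginSverak2009.IsAxisDecayOnCyl`,
`SereginSverak2009.isRegularAtOrigin_of_axisDecay`). For CLASSICAL finite-energy solutions from a
datum with bounded circulation `Γ₀ = r u₀^θ ∈ L^∞` (automatic for rapidly decaying data) the two
forms are equivalent, because the swirl obeys the maximum principle `|r u^θ(t,x)| ≤ ‖Γ₀‖_∞`
(`abs_swirl_le_of_classical`, DISCHARGED) and `r|u| ≤ r|ū| + |r u^θ|` pointwise. This file
records that equivalence as kernel theorems, so that the sharpened census hypothesis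
"a singular continuation of an axisymmetric classical solution requires `sup r|u_pol| → ∞`"
has a declaration to name:

* `cylRadius_mul_norm_le_poloidal_add_abs_swirl` — `r‖u x‖ ≤ r‖ū x‖ + |Γ x|`, `ū = poloidalPart u`;
* `abs_swirl_le_of_classical_Ico` — the swirl maximum principle on the half-open lifespan
  `[0, T)` under the sub-slab bounds (from `abs_swirl_le_of_classical` on each `[0, T']`);
* `hasSmoothExtensionPast_of_poloidal_axisDecay` — classical axisymmetric Leray–Hopf solution on
  `[0, T)`, bounded on sub-slabs, `|Γ₀| ≤ M`, and `r‖ū(t,x)‖ ≤ C` on `[0,T) × ℝ³` ⇒ the solution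
  extends smoothly past `T`; `…_of_rapidDecay` — the same for a rapidly decaying datum;
* `exists_poloidal_axisDecay_gt_of_isMaximalSmoothSolution` — kill form: if `T` IS the lifespan,
  `r‖ū‖` is unbounded on `[0, T) × ℝ³`;
* `knss_bound_C_over_r_of_poloidal` — the Liouville side (KNSS 2009, Thm. 5.3) for bounded ancient
  mild axisymmetric solutions with bounded swirl and `r‖ū‖ ≤ C`: `u ≡ 0`; kill form for the inner
  object of a blow-up zoom, `exists_poloidal_axisDecay_gt_of_ancient_nontrivial`;
* `SereginSverak2009.isRegularAtOrigin_of_poloidalAxisDecay` — the LOCAL form (Thm. 3.2 on the unit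
  cylinder with (r4) on the poloidal part + an a.e. swirl bound), valid at interior axis points of
  any axisymmetric flow (pipe or whole space), from the unconditional
  `SereginSverak2009.isRegularAtOrigin_of_axisDecay_holds`.

No new named fact is introduced (net debt 0): everything is derived from the discharged tree
theorems named above.

WHAT THIS IS NOT: not a claim about Navier–Stokes blow-up or regularity beyond the cited,
kernel-checked criteria; it re-expresses a discharged criterion on the poloidal component.

## References

* G. Seregin, V. Šverák, *On Type I singularities of the local axi-symmetric solutions of the
  Navier–Stokes equations*, Comm. PDE 34 (2009) 171–201, arXiv:0804.1803: §1 p. 2 (1.2), p. 3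
  Thm. 1.2; §3 p. 9 Thm. 3.2, Lemma 3.3 (the swirl bound `|x'||v_φ| ≤ C₂` on `Q(1/2)`).
  [`SereginSverak2009`]
* G. Koch, N. Nadirashvili, G. Seregin, V. Šverák, Acta Math. 203 (2009) 83–105,
  arXiv:0709.3599, Thm. 6.1. [`KochNadirashviliSereginSverak2009`]
* D. Chae, J. Lee, Math. Z. 239 (2002), §1 (maximum principle for `r u^θ`). [`ChaeLee2002`]
-/

noncomputable section

open MeasureTheory Set Function Filter Topology TopologicalSpace

namespace Literature.Analysis.FluidPDE

/-! ### Pointwise: full velocity against poloidal part plus swirl -/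

/-- **`r |u| ≤ r |ū| + |Γ|`**: with `ū = poloidalPart u = u - u^θ e_θ` and `Γ = swirl u = r u^θ`,
the cylindrical frame being orthonormal off the axis (`‖u‖² = ‖ū‖² + (u^θ)²`,
`norm_poloidalPart_sq`) and both sides vanishing on it. This is the inequality behind
Seregin–Šverák's remark that their hypotheses need only be imposed on `v̄`.
[cite: SereginSverak2009, §1 p. 2 (1.2) and §3 Lemma 3.3] -/
theorem cylRadius_mul_norm_le_poloidal_add_abs_swirl
    (u : (EuclideanSpace ℝ (Fin 3)) → (EuclideanSpace ℝ (Fin 3))) (x : (EuclideanSpace ℝ (Fin 3))) :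
    cylRadius x * ‖u x‖ ≤ cylRadius x * ‖poloidalPart u x‖ + |swirl u x| := by
  by_cases hx : cylRadius x = 0
  · rw [hx, zero_mul, zero_mul, zero_add]
    exact abs_nonneg _
  · have hr : 0 < cylRadius x := lt_of_le_of_ne (cylRadius_nonneg x) (Ne.symm hx)
    have hsq := norm_poloidalPart_sq u hx
    -- `‖u x‖ ≤ ‖ū x‖ + |u^θ x|`
    have h1 : ‖u x‖ ≤ ‖poloidalPart u x‖ + |swirlVelocity u x| := by
      have h2 : ‖u x‖ ^ 2 ≤ (‖poloidalPart u x‖ + |swirlVelocity u x|) ^ 2 := by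
        nlinarith [norm_nonneg (poloidalPart u x), abs_nonneg (swirlVelocity u x),
          sq_abs (swirlVelocity u x)]
      exact (sq_le_sq₀ (norm_nonneg _) (by positivity)).1 h2
    have h3 : |swirl u x| = cylRadius x * |swirlVelocity u x| := by
      rw [swirl_eq_cylRadius_mul_swirlVelocity u hx, abs_mul, abs_of_pos hr]
    rw [h3, ← mul_add]
    exact mul_le_mul_of_nonneg_left h1 hr.le

/-- A uniform bound `r‖ū‖ ≤ C` on the poloidal part and a uniform bound `|Γ| ≤ M` on the swirl give
the uniform bound `r‖u‖ ≤ C + M` on the full velocity (how hypothesis (1.2) on `v̄` and the swirl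
bound of Lemma 3.3 combine in Seregin–Šverák's §3–§4).
[cite: SereginSverak2009, §1 (1.2) with §3 Lemma 3.3 (as7)] -/
theorem cylRadius_mul_norm_le_of_poloidal_of_swirl
    {u : (EuclideanSpace ℝ (Fin 3)) → (EuclideanSpace ℝ (Fin 3))} {C M : ℝ}
    (hC : ∀ x, cylRadius x * ‖poloidalPart u x‖ ≤ C) (hM : ∀ x, |swirl u x| ≤ M)
    (x : (EuclideanSpace ℝ (Fin 3))) :
    cylRadius x * ‖u x‖ ≤ C + M :=
  (cylRadius_mul_norm_le_poloidal_add_abs_swirl u x).trans (add_le_add (hC x) (hM x))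

/-- Conversely `r‖ū‖ ≤ r‖u‖` (`‖ū‖ ≤ ‖u‖`, `norm_poloidalPart_le`): the full-velocity hypothesis of
`knss_no_axisymmetric_typeI` implies the poloidal one (`v̄` is the orthogonal projection of `v`
onto the meridional plane, Seregin–Šverák §1 p. 2 / §3 p. 9: `v̄ = v_ϱ e_ϱ + v₃ e₃`).
[cite: SereginSverak2009, §3 p. 9 (definition of v̄)] -/
theorem cylRadius_mul_norm_poloidalPart_le
    (u : (EuclideanSpace ℝ (Fin 3)) → (EuclideanSpace ℝ (Fin 3))) (x : (EuclideanSpace ℝ (Fin 3))) :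
    cylRadius x * ‖poloidalPart u x‖ ≤ cylRadius x * ‖u x‖ :=
  mul_le_mul_of_nonneg_left (norm_poloidalPart_le u x) (cylRadius_nonneg x)

/-! ### The swirl maximum principle on the half-open lifespan -/

/-- **Maximum principle for the swirl on `[0, T)`** (Chae–Lee 2002, §1; KNSS 2009, (1.9)): for a
classical axisymmetric solution on `[0, T)` which is bounded on every sub-slab `[0, T'] × ℝ³`,
`T' < T`, a bound `|Γ(0, ·)| ≤ M` on the swirl of the datum propagates to all `t ∈ [0, T)`.
Derived from the discharged `abs_swirl_le_of_classical` on `[0, T']`, `T' = (t + T)/2`.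
[cite: ChaeLee2002, §1] -/
theorem abs_swirl_le_of_classical_Ico {T ν M : ℝ}
    {u : ℝ → (EuclideanSpace ℝ (Fin 3)) → (EuclideanSpace ℝ (Fin 3))}
    {p : ℝ → (EuclideanSpace ℝ (Fin 3)) → ℝ}
    (hν : 0 < ν) (hcl : IsClassicalNSSolutionOn (Ico 0 T) ν 0 u p)
    (haxi : ∀ t ∈ Ico 0 T, IsAxisymmetric (u t))
    (hbdd : ∀ T' < T, ∃ V : ℝ, ∀ t ∈ Icc 0 T', ∀ x, ‖u t x‖ ≤ V)
    (hM : ∀ x, |swirl (u 0) x| ≤ M) :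
    ∀ t ∈ Ico 0 T, ∀ x, |swirl (u t) x| ≤ M := by
  intro t ht x
  set T' : ℝ := (t + T) / 2 with hT'
  have hT'pos : 0 < T' := by rw [hT']; linarith [ht.1, ht.2]
  have hT'T : T' < T := by rw [hT']; linarith [ht.2]
  have htT' : t ≤ T' := by rw [hT']; linarith [ht.2]
  have hsub : Icc 0 T' ⊆ Ico 0 T := fun s hs => ⟨hs.1, hs.2.trans_lt hT'T⟩
  have hcl' : IsClassicalNSSolutionOn (Icc 0 T') ν 0 u p := hcl.mono hsub (uniqueDiffOn_Icc hT'pos)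
  obtain ⟨V, hV⟩ := hbdd T' hT'T
  exact abs_swirl_le_of_classical hν hT'pos hcl' (fun s hs => haxi s (hsub hs)) hV hM t
    ⟨ht.1, htT'⟩ x

/-! ### No blow-up under the poloidal `C/r` bound -/

/-- **No axisymmetric blow-up under a `C/r` bound on the poloidal velocity** (Seregin–Šverák 2009,
Thm. 1.2 with hypothesis (1.2) on `v̄ = v_ϱ e_ϱ + v₃ e₃`; KNSS 2009, Thm. 6.1), for classical
finite-energy solutions with bounded initial circulation. Let `ν > 0`, `T > 0`, `(u, p)` a
classical solution of Navier–Stokes (`f = 0`) on `ℝ³ × [0, T)` which is Leray–Hopf on `[0, T)`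
from `u 0`, bounded on `ℝ³ × [0, T']` for every `T' < T`, with axisymmetric slices, whose datum
has bounded swirl `|r u^θ(0, x)| ≤ M`, and whose POLOIDAL part obeys `r ‖ū(t, x)‖ ≤ C` on
`[0, T) × ℝ³`. Then `T` is not a blow-up time: `u` extends as a classical solution past `T`.
PROOF: the swirl maximum principle (`abs_swirl_le_of_classical_Ico`) and
`cylRadius_mul_norm_le_of_poloidal_of_swirl` give `r‖u‖ ≤ C + M` on `[0, T) × ℝ³`, the second
alternative of the discharged `knss_no_axisymmetric_typeI_holds`.
[cite: SereginSverak2009, Thm 1.2 (arXiv p. 3) with (1.2) (p. 2)] -/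
theorem hasSmoothExtensionPast_of_poloidal_axisDecay {ν T : ℝ} (hν : 0 < ν) (hT : 0 < T)
    {u : ℝ → (EuclideanSpace ℝ (Fin 3)) → (EuclideanSpace ℝ (Fin 3))}
    {p : ℝ → (EuclideanSpace ℝ (Fin 3)) → ℝ} (h : IsClassicalNSSolutionOn (Ico 0 T) ν 0 u p)
    (hLH : IsLerayHopfOn T ν 0 (u 0) u)
    (hbdd : ∀ T' < T, ∃ M : ℝ, ∀ t ∈ Icc 0 T', ∀ x, ‖u t x‖ ≤ M)
    (haxi : ∀ t ∈ Ico 0 T, IsAxisymmetric (u t))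
    (hΓ₀ : ∃ M : ℝ, ∀ x, |swirl (u 0) x| ≤ M)
    (hpol : ∃ C : ℝ, ∀ t ∈ Ico 0 T, ∀ x, cylRadius x * ‖poloidalPart (u t) x‖ ≤ C) :
    HasSmoothExtensionPast ν 0 u T := by
  obtain ⟨M, hM⟩ := hΓ₀
  obtain ⟨C, hC⟩ := hpol
  have hΓ := abs_swirl_le_of_classical_Ico hν h haxi hbdd hM
  refine knss_no_axisymmetric_typeI_holds hν hT h hLH hbdd haxi (Or.inr ⟨C + M, ?_⟩)
  intro t ht x
  exact cylRadius_mul_norm_le_of_poloidal_of_swirl (hC t ht) (hΓ t ht) x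

/-- **The same for a rapidly decaying datum** (the Clay / Schwartz class):
`HasRapidSpatialDecay (u 0)` gives the swirl bound of the datum
(`HasRapidSpatialDecay.abs_swirl_le`), so only the poloidal
`C/r` bound is a hypothesis. [cite: SereginSverak2009, Thm 1.2 (arXiv p. 3) with (1.2) (p. 2)] -/
theorem hasSmoothExtensionPast_of_poloidal_axisDecay_of_rapidDecay {ν T : ℝ} (hν : 0 < ν)
    (hT : 0 < T) {u : ℝ → (EuclideanSpace ℝ (Fin 3)) → (EuclideanSpace ℝ (Fin 3))}
    {p : ℝ → (EuclideanSpace ℝ (Fin 3)) → ℝ} (h : IsClassicalNSSolutionOn (Ico 0 T) ν 0 u p)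
    (hLH : IsLerayHopfOn T ν 0 (u 0) u)
    (hbdd : ∀ T' < T, ∃ M : ℝ, ∀ t ∈ Icc 0 T', ∀ x, ‖u t x‖ ≤ M)
    (haxi : ∀ t ∈ Ico 0 T, IsAxisymmetric (u t)) (hdecay : HasRapidSpatialDecay (u 0))
    (hpol : ∃ C : ℝ, ∀ t ∈ Ico 0 T, ∀ x, cylRadius x * ‖poloidalPart (u t) x‖ ≤ C) :
    HasSmoothExtensionPast ν 0 u T :=
  hasSmoothExtensionPast_of_poloidal_axisDecay hν hT h hLH hbdd haxi hdecay.abs_swirl_le hpol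

/-- **The full-velocity criterion implies the poloidal one** (sanity: the new hypothesis is
weaker): `r‖u‖ ≤ C` on `[0, T) × ℝ³` gives `r‖ū‖ ≤ C` there — Seregin–Šverák's (1.2) is
implied by the full-velocity bound of KNSS 2009, Thm. 6.1.
[cite: SereginSverak2009, §1 (1.2) (arXiv p. 2)] -/
theorem poloidal_axisDecay_of_axisDecay {T : ℝ}
    {u : ℝ → (EuclideanSpace ℝ (Fin 3)) → (EuclideanSpace ℝ (Fin 3))}
    (hfull : ∃ C : ℝ, ∀ t ∈ Ico 0 T, ∀ x, cylRadius x * ‖u t x‖ ≤ C) :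
    ∃ C : ℝ, ∀ t ∈ Ico 0 T, ∀ x, cylRadius x * ‖poloidalPart (u t) x‖ ≤ C := by
  obtain ⟨C, hC⟩ := hfull
  exact ⟨C, fun t ht x => (cylRadius_mul_norm_poloidalPart_le (u t) x).trans (hC t ht x)⟩

/-! ### Kill form: at a genuine lifespan the poloidal `r|ū|` is unbounded -/

/-- **At a blow-up time the weighted poloidal velocity `r |ū|` is unbounded** (contrapositive
of `hasSmoothExtensionPast_of_poloidal_axisDecay`): if `(u, p)` is a maximal smooth solution with
lifespan `T` (`IsMaximalSmoothSolution`: classical on `[0, T)` and NOT extendable past `T`) which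
is Leray–Hopf from `u 0`, bounded on sub-slabs, axisymmetric, with bounded initial swirl, then
for every `C` there are `t ∈ [0, T)` and `x` with `C < r ‖ū(t, x)‖`. This is the form in which the
criterion is read against axisymmetric numerical blow-up candidates ("a singular continuation
requires `sup r|u_pol| → ∞`"). [cite: SereginSverak2009, Thm 1.2 (arXiv p. 3) with (1.2) (p. 2)] -/
theorem exists_poloidal_axisDecay_gt_of_isMaximalSmoothSolution {ν T : ℝ} (hν : 0 < ν)
    (hT : 0 < T) {u : ℝ → (EuclideanSpace ℝ (Fin 3)) → (EuclideanSpace ℝ (Fin 3))}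
    {p : ℝ → (EuclideanSpace ℝ (Fin 3)) → ℝ} (hmax : IsMaximalSmoothSolution ν 0 u p T)
    (hLH : IsLerayHopfOn T ν 0 (u 0) u)
    (hbdd : ∀ T' < T, ∃ M : ℝ, ∀ t ∈ Icc 0 T', ∀ x, ‖u t x‖ ≤ M)
    (haxi : ∀ t ∈ Ico 0 T, IsAxisymmetric (u t)) (hΓ₀ : ∃ M : ℝ, ∀ x, |swirl (u 0) x| ≤ M)
    (C : ℝ) : ∃ t ∈ Ico 0 T, ∃ x, C < cylRadius x * ‖poloidalPart (u t) x‖ := by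
  by_contra hcon
  push Not at hcon
  exact hmax.2 (hasSmoothExtensionPast_of_poloidal_axisDecay hν hT hmax.1 hLH hbdd haxi hΓ₀
    ⟨C, hcon⟩)

/-- The same kill form for a rapidly decaying datum.
[cite: SereginSverak2009, Thm 1.2 (arXiv p. 3) with (1.2) (p. 2)] -/
theorem exists_poloidal_axisDecay_gt_of_isMaximalSmoothSolution_of_rapidDecay {ν T : ℝ}
    (hν : 0 < ν) (hT : 0 < T) {u : ℝ → (EuclideanSpace ℝ (Fin 3)) → (EuclideanSpace ℝ (Fin 3))}
    {p : ℝ → (EuclideanSpace ℝ (Fin 3)) → ℝ}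
    (hmax : IsMaximalSmoothSolution ν 0 u p T) (hLH : IsLerayHopfOn T ν 0 (u 0) u)
    (hbdd : ∀ T' < T, ∃ M : ℝ, ∀ t ∈ Icc 0 T', ∀ x, ‖u t x‖ ≤ M)
    (haxi : ∀ t ∈ Ico 0 T, IsAxisymmetric (u t)) (hdecay : HasRapidSpatialDecay (u 0))
    (C : ℝ) : ∃ t ∈ Ico 0 T, ∃ x, C < cylRadius x * ‖poloidalPart (u t) x‖ :=
  exists_poloidal_axisDecay_gt_of_isMaximalSmoothSolution hν hT hmax hLH hbdd haxi
    hdecay.abs_swirl_le C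

/-! ### Liouville form: bounded ancient solutions (the inner object of a blow-up zoom) -/

/-- **KNSS 2009, Thm. 5.3, with the `C/r` bound on the poloidal part** (the Liouville side of
Seregin–Šverák 2009, Thm. 1.2 / hypothesis (1.2) on `v̄`): a bounded ancient mild solution of
Navier–Stokes (`ν = 1`) with measurable, axisymmetric slices, BOUNDED SWIRL `|Γ(t,x)| ≤ M` (as
inherited by every blow-up limit of a classical solution with `Γ₀ ∈ L^∞`, `Γ` being
scale-invariant) and `r ‖ū(t, x)‖ ≤ C` on `(-∞, 0) × ℝ³` vanishes: `u(t) = 0` a.e. for every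
`t < 0`. From the discharged `knss_bound_C_over_r_holds` (hypothesis `r‖u‖ ≤ C'` on the full
velocity) and `cylRadius_mul_norm_le_of_poloidal_of_swirl`.
[cite: KochNadirashviliSereginSverak2009, Thm 5.3; SereginSverak2009, §1 (1.2) (arXiv p. 2)] -/
theorem knss_bound_C_over_r_of_poloidal {u : ℝ → EuclideanSpace ℝ (Fin 3) → EuclideanSpace ℝ (Fin 3)}
    (hu : IsBoundedAncientMildSolution 1 u) (hmeas : ∀ t < 0, AEStronglyMeasurable (u t) volume)
    (haxi : ∀ t < 0, IsAxisymmetric (u t)) (hΓ : ∃ M : ℝ, ∀ t < 0, ∀ x, |swirl (u t) x| ≤ M)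
    (hpol : ∃ C : ℝ, ∀ t < 0, ∀ x, cylRadius x * ‖poloidalPart (u t) x‖ ≤ C) :
    ∀ t < 0, u t =ᵐ[volume] 0 := by
  obtain ⟨M, hM⟩ := hΓ
  obtain ⟨C, hC⟩ := hpol
  exact knss_bound_C_over_r_holds hu hmeas haxi
    ⟨C + M, fun t ht x => cylRadius_mul_norm_le_of_poloidal_of_swirl (hC t ht) (hM t ht) x⟩

/-- **Kill form for the inner object**: a bounded ancient mild axisymmetric solution with bounded
swirl which is NOT trivial (some slice `u(t)`, `t < 0`, is not a.e. zero) has unbounded weighted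
poloidal velocity: for every `C` there are `t < 0` and `x` with `C < r ‖ū(t, x)‖` — the by-name
form of "violates the `C/r` hypothesis on `(V^r, V^z)`" for blow-up limits.
[cite: KochNadirashviliSereginSverak2009, Thm 5.3; SereginSverak2009, §1 (1.2) (arXiv p. 2)] -/
theorem exists_poloidal_axisDecay_gt_of_ancient_nontrivial {u : ℝ → EuclideanSpace ℝ (Fin 3) → EuclideanSpace ℝ (Fin 3)}
    (hu : IsBoundedAncientMildSolution 1 u) (hmeas : ∀ t < 0, AEStronglyMeasurable (u t) volume)
    (haxi : ∀ t < 0, IsAxisymmetric (u t)) (hΓ : ∃ M : ℝ, ∀ t < 0, ∀ x, |swirl (u t) x| ≤ M)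
    (hne : ∃ t < 0, ¬ (u t =ᵐ[volume] 0)) (C : ℝ) :
    ∃ t < 0, ∃ x, C < cylRadius x * ‖poloidalPart (u t) x‖ := by
  by_contra hcon
  push Not at hcon
  obtain ⟨t, ht, hne⟩ := hne
  exact hne (knss_bound_C_over_r_of_poloidal hu hmeas haxi hΓ ⟨C, hcon⟩ t ht)

/-! ### Local form: Seregin–Šverák's Theorem 3.2 with (r4) on the poloidal part -/

namespace SereginSverak2009

/-- **Seregin–Šverák 2009, Thm. 3.2 (local, unit cylinder) with the `C/|x'|` bound on the
poloidal part and a bounded swirl** — the LOCAL statement, which applies at interior axis points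
of ANY axisymmetric flow (whole space, periodic pipe, bounded cylinder with a wall away from the
point): under the standing assumptions of §3 with axial symmetry (`IsAxisymmetricLocalSolution`),
(r2) (`IsBoundedAwayFromZero`), an a.e. bound `|Γ| ≤ M` on the swirl in `Q` (for a smooth flow:
the circulation maximum principle from the datum) and `|x'| ‖ū(t,x)‖ ≤ C` a.e. in `Q` on the
POLOIDAL part, the origin is a regular point. From the tree's unconditional Thm. 3.2
(`isRegularAtOrigin_of_axisDecay_holds`, hypothesis (r4) on the full velocity) and
`cylRadius_mul_norm_le_poloidal_add_abs_swirl`; this is hypothesis (1.2) of §1 as printed (on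
`v̄`), the swirl being bounded separately (in print by Lemma 3.3, here by hypothesis).
[cite: SereginSverak2009, Thm 1.2 / Thm 3.2 with (1.2) (arXiv pp. 2-3, 9) and Lemma 3.3 (as7)] -/
theorem isRegularAtOrigin_of_poloidalAxisDecay {u : ℝ → EuclideanSpace ℝ (Fin 3) → EuclideanSpace ℝ (Fin 3)}
    {p : ℝ → EuclideanSpace ℝ (Fin 3) → ℝ} (hsol : IsAxisymmetricLocalSolution u p)
    (hr2 : IsBoundedAwayFromZero u)
    (hΓ : ∃ M : ℝ, ∀ᵐ z ∂(volume.restrict (parCyl 0 1)), |swirl (u z.1) z.2| ≤ M)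
    (hpol : ∃ C : ℝ, ∀ᵐ z ∂(volume.restrict (parCyl 0 1)),
      cylRadius z.2 * ‖poloidalPart (u z.1) z.2‖ ≤ C) :
    IsRegularAtOrigin u := by
  obtain ⟨M, hM⟩ := hΓ
  obtain ⟨C, hC⟩ := hpol
  refine isRegularAtOrigin_of_axisDecay_holds hsol hr2 ⟨C + M, ?_⟩
  filter_upwards [hM, hC] with z hzM hzC
  exact (cylRadius_mul_norm_le_poloidal_add_abs_swirl (u z.1) z.2).trans (add_le_add hzC hzM)

/-- The same with the swirl bound given on every slice `-1 < t < 0` and every point (the form a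
maximum principle delivers). [cite: SereginSverak2009, Thm 1.2 / Thm 3.2 with (1.2) (arXiv pp. 2-3, 9)] -/
theorem isRegularAtOrigin_of_poloidalAxisDecay' {u : ℝ → EuclideanSpace ℝ (Fin 3) → EuclideanSpace ℝ (Fin 3)}
    {p : ℝ → EuclideanSpace ℝ (Fin 3) → ℝ} (hsol : IsAxisymmetricLocalSolution u p)
    (hr2 : IsBoundedAwayFromZero u)
    (hΓ : ∃ M : ℝ, ∀ t ∈ Ioo (-1 : ℝ) 0, ∀ x, |swirl (u t) x| ≤ M)
    (hpol : ∃ C : ℝ, ∀ᵐ z ∂(volume.restrict (parCyl 0 1)),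
      cylRadius z.2 * ‖poloidalPart (u z.1) z.2‖ ≤ C) :
    IsRegularAtOrigin u := by
  obtain ⟨M, hM⟩ := hΓ
  refine isRegularAtOrigin_of_poloidalAxisDecay hsol hr2 ⟨M, ?_⟩ hpol
  refine (ae_restrict_mem (isOpen_parCyl 0 1).measurableSet).mono fun z hz => ?_
  obtain ⟨hs, -, -⟩ := mem_parCyl_zero.1 hz
  exact hM z.1 (by simpa using hs) z.2

end SereginSverak2009

end Literature.Analysis.FluidPDE

end
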